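import Literature.NumberTheory.GaloisRepresentations.ContinuousCohomologyTowerLimitInjective
import HarnessLib

/-!
# Continuous `H²` of an inverse limit of discrete modules, III: naturality in the group and the tower

Neukirch–Schmidt–Wingberg, *Cohomology of Number Fields* (2nd ed. 2008), II §7: the comparison
`H²_cts(G, lim_{← i} X_i) → lim_{← i} H²(G, X_i)` of Thm. (2.7.5) is NATURAL — in the coefficients
(a levelwise morphism of towers) and in the group (restriction / pull-back along a continuous
homomorphism `φ : H → G`, in particular along the inclusion of an open subgroup and along
isomorphisms).  This file records that naturality for the tree's `ℕ`-towers
(`DiscreteTowerPresentation`, files `ContinuousCohomologyTowerLimit(Injective).lean`: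
`toLimitClasses`, `limitClassesEquiv`), in the generality of Mathlib's functoriality of continuous
cohomology `ContinuousCohomology.map φ f n` along a compatible pair
`(φ : H →ₜ* G, f : res φ X ⟶ Y)`:

* `DiscreteTowerPresentation.restrict P φ` — the tower `res φ X = lim res φ X_i` over `H`;
* `DiscreteTowerPresentation.Hom φ P Q` — a morphism of towers OVER `φ`: a limit-level
  `f : res φ X ⟶ Y` and levelwise `f_i : res φ X_i ⟶ Y_i` commuting with projections and
  transitions; `Hom.ofLevels` builds the limit-level map from the levels alone;
* `Hom.limitClassesMap` — the induced map `lim_i H²(G, X_i) → lim_i H²(H, Y_i)`,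
  `(c_i)_i ↦ (H²(φ, f_i) c_i)_i`;
* **the square** `Hom.cohomologyMap_proj_map` / `Hom.toLimitClasses_map` /
  `Hom.limitClassesEquiv_map` / `Hom.map_limitClassesEquiv_symm`:
  `H²(proj_i) ∘ H²(φ, f) = H²(φ, f_i) ∘ H²(proj_i)`, i.e. the comparison isomorphism
  `H²(G, lim X_i) ≅ lim H²(G, X_i)` intertwines `H²(φ, f)` with the levelwise maps — so a map on
  `H²` of a limit is COMPUTED, and (by injectivity, `Hom.map_eq_of_levels`) DETERMINED, levelwise;
* the restriction instance `restrictHom` (`f = 𝟙`): `cohomologyMap_proj_res`.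

Instance of record in the tree (abc-iut cell, layer L4): for a finite extension `k′/k` of `p`-adic
fields the square for `galCyclotomeTower` along `absGaloisRestrict k k′` is
`cohomologyMap_cycProj_galCyclotomeRes` (abc-iut-w5-d201, `GaloisCyclotomeRestrictionIndex.lean`),
whence the index formula of [AbsTopIII] Rmk. 1.10.1 (iii); the present file is its abstract form
(any tower, any `φ`), consumed by the open-injection / isomorphism functoriality of [AbsTopIII]
Cor. 1.10 (i) (rows «COR110ia-NAT(-OPEN)», «COR110ib-OPEN»).  Classical, undisputed homological
algebra; nothing here bears on [IUTchIII] Cor. 3.12.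

## References

* J. Neukirch, A. Schmidt, K. Wingberg, *Cohomology of Number Fields*, 2nd ed. (2008), II §7,
  (2.7.5), (2.7.6); I §5 (functoriality, (1.5.2)). [NeukirchSchmidtWingberg2008]
* J.-P. Serre, *Galois Cohomology* (1997), I §2.2–2.4. [SerreGaloisCohomology1997]
-/

noncomputable section

open CategoryTheory Function

universe u v

namespace Literature.NumberTheory.GaloisRepresentations

open TopRep ContRepresentation ContinuousCohomology

variable {R : Type u} [CommRing R] [TopologicalSpace R]
variable {G : Type v} [Group G] [TopologicalSpace G] [IsTopologicalGroup G]
variable {H : Type v} [Group H] [TopologicalSpace H] [IsTopologicalGroup H]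

/-! ### `H²(φ, f)` on explicit cocycles, `.hom` form -/

section MapHom

variable [LocallyCompactSpace G] [LocallyCompactSpace H] {X : TopRep.{v} R G} {Y : TopRep.{v} R H}

/-- `H²(φ, f)[z] = [f ∘ z ∘ (φ × φ)]`, stated for the continuous linear map underlying Mathlib's
`ContinuousCohomology.map φ f 2` (the tree's `map_twoCocycleClass`).
[cite: SerreGaloisCohomology1997, I §2.4] -/
theorem map_hom_twoCocycleClass (φ : H →ₜ* G) (f : res (φ : H →* G) X ⟶ Y)
    (z : contTwoCocycles X) :
    (ContinuousCohomology.map φ f 2).hom (twoCocycleClass X z) =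
      twoCocycleClass Y (contTwoCocycles.pullback φ f z) :=
  map_twoCocycleClass _ _ _ z

end MapHom

namespace DiscreteTowerPresentation

/-! ### Restricting a tower along a continuous homomorphism `φ : H → G` -/

section Restrict

variable {X : TopRep.{v} R G} (P : DiscreteTowerPresentation X) (φ : H →ₜ* G)

/-- **The restricted tower**: if `X = lim X_i` is presented by the tower `P` over `G`, then
`res φ X = lim res φ X_i` is presented over `H` by the same spaces and maps, the actions pulled
back along `φ` (e.g. `φ` the inclusion of an open subgroup `G_{k′} ≤ G_k`, or an isomorphism).
[cite: NeukirchSchmidtWingberg2008, II §7 (2.7.5)] -/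
def restrict : DiscreteTowerPresentation (res (φ : H →* G) X) where
  obj i := res (φ : H →* G) (P.obj i)
  tr i := (resFunctor (φ : H →* G)).map (P.tr i)
  proj i := (resFunctor (φ : H →* G)).map (P.proj i)
  tr_proj i x := P.tr_proj i x
  discrete i := P.discrete i
  continuous_action i := (P.continuous_action i).comp (φ.continuous.prodMap continuous_id)
  tr_surjective i := P.tr_surjective i
  proj_injective := P.proj_injective
  proj_lift := P.proj_lift
  isInducing := P.isInducing

omit [IsTopologicalGroup G] [IsTopologicalGroup H] in
/-- Levels of the restricted tower. [cite: NeukirchSchmidtWingberg2008, II §7 (2.7.5)] -/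
@[simp] theorem restrict_obj (i : ℕ) : (P.restrict φ).obj i = res (φ : H →* G) (P.obj i) := rfl

omit [IsTopologicalGroup G] [IsTopologicalGroup H] in
/-- Transition maps of the restricted tower, on elements.
[cite: NeukirchSchmidtWingberg2008, II §7 (2.7.5)] -/
@[simp] theorem restrict_tr_hom_apply (i : ℕ) (x : P.obj (i + 1)) :
    ((P.restrict φ).tr i).hom x = (P.tr i).hom x := rfl

omit [IsTopologicalGroup G] [IsTopologicalGroup H] in
/-- Projections of the restricted tower, on elements.
[cite: NeukirchSchmidtWingberg2008, II §7 (2.7.5)] -/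
@[simp] theorem restrict_proj_hom_apply (i : ℕ) (x : X) :
    ((P.restrict φ).proj i).hom x = (P.proj i).hom x := rfl

end Restrict

/-! ### Morphisms of towers over a continuous homomorphism -/

/-- **A morphism of towers over `φ : H → G`** from a tower `P` presenting `X` (over `G`) to a tower
`Q` presenting `Y` (over `H`): a compatible pair at the limit level, `map : res φ X ⟶ Y`, and at
each level, `level i : res φ X_i ⟶ Y_i`, commuting with the projections and the transition maps.
Examples: restriction to an open subgroup (`restrictHom`, all maps identities); the maps
`μ_n(k̄₁) → μ_n(k̄₂)` induced by a field isomorphism over an isomorphism of Galois groups.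
[cite: NeukirchSchmidtWingberg2008, II §7 (2.7.5)] -/
structure Hom (φ : H →ₜ* G) {X : TopRep.{v} R G} {Y : TopRep.{v} R H}
    (P : DiscreteTowerPresentation X) (Q : DiscreteTowerPresentation Y) where
  /-- the limit-level map `X → Y` over `φ` -/
  map : res (φ : H →* G) X ⟶ Y
  /-- the level-`i` map `X_i → Y_i` over `φ` -/
  level : ∀ i, res (φ : H →* G) (P.obj i) ⟶ Q.obj i
  /-- compatibility with the projections -/
  proj_map : ∀ (i : ℕ) (x : X), (Q.proj i).hom (map.hom x) = (level i).hom ((P.proj i).hom x)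
  /-- compatibility with the transition maps -/
  tr_level : ∀ (i : ℕ) (x : P.obj (i + 1)),
    (Q.tr i).hom ((level (i + 1)).hom x) = (level i).hom ((P.tr i).hom x)

/-- **Restriction as a morphism of towers** over `φ`, from `P` to `P.restrict φ` (identities at
every level). [cite: NeukirchSchmidtWingberg2008, II §7 (2.7.5)] -/
def restrictHom {X : TopRep.{v} R G} (P : DiscreteTowerPresentation X) (φ : H →ₜ* G) :
    Hom φ P (P.restrict φ) where
  map := 𝟙 (res (φ : H →* G) X)
  level i := 𝟙 (res (φ : H →* G) (P.obj i))
  proj_map _ _ := rfl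
  tr_level _ _ := rfl

/-! ### The limit-level map from the levels -/

section OfLevels

variable {φ : H →ₜ* G} {X : TopRep.{v} R G} {Y : TopRep.{v} R H}
  (P : DiscreteTowerPresentation X) (Q : DiscreteTowerPresentation Y)
  (f : ∀ i, res (φ : H →* G) (P.obj i) ⟶ Q.obj i)
  (hf : ∀ (i : ℕ) (x : P.obj (i + 1)), (Q.tr i).hom ((f (i + 1)).hom x) = (f i).hom ((P.tr i).hom x))

omit [IsTopologicalGroup G] [IsTopologicalGroup H] in
include hf in
/-- The levelwise images of the projections of `x ∈ X` form a compatible family in the tower `Q`.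
[cite: NeukirchSchmidtWingberg2008, II §7 (2.7.5)] -/
theorem levels_compat (x : X) (i : ℕ) :
    (Q.tr i).hom ((f (i + 1)).hom ((P.proj (i + 1)).hom x)) = (f i).hom ((P.proj i).hom x) := by
  rw [hf, P.tr_proj]

/-- The function `X → Y` glued from the levels: `x ↦` the element of `Y = lim Y_i` with components
`f_i (proj_i x)`. [cite: NeukirchSchmidtWingberg2008, II §7 (2.7.5)] -/
def ofLevelsFun (x : X) : Y :=
  (Q.proj_lift (fun i => (f i).hom ((P.proj i).hom x)) (levels_compat P Q f hf x)).choose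

omit [IsTopologicalGroup G] [IsTopologicalGroup H] in
/-- Components of `ofLevelsFun`. [cite: NeukirchSchmidtWingberg2008, II §7 (2.7.5)] -/
@[simp] theorem proj_ofLevelsFun (x : X) (i : ℕ) :
    (Q.proj i).hom (ofLevelsFun P Q f hf x) = (f i).hom ((P.proj i).hom x) :=
  (Q.proj_lift (fun i => (f i).hom ((P.proj i).hom x)) (levels_compat P Q f hf x)).choose_spec i

/-- **The limit-level map glued from the levels**, as a morphism `res φ X ⟶ Y` of topological
representations of `H` (additive, `R`-linear, continuous and equivariant because its components
are and the projections of `Q` are jointly injective and inducing).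
[cite: NeukirchSchmidtWingberg2008, II §7 (2.7.5)] -/
def ofLevelsMap : res (φ : H →* G) X ⟶ Y :=
  TopRep.ofHom
    ⟨{ toFun := ofLevelsFun P Q f hf
       map_add' := fun x y => Q.proj_injective _ _ fun i => by
         simp only [map_add, proj_ofLevelsFun]
       map_smul' := fun r x => Q.proj_injective _ _ fun i => by
         simp only [map_smul, proj_ofLevelsFun, RingHom.id_apply]
       cont := by
         rw [Q.isInducing.continuous_iff]
         exact continuous_pi fun i => by
           have hc : Continuous fun x : X => (f i).hom ((P.proj i).hom x) :=
             (f i).hom.continuous.comp (P.proj i).hom.continuous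
           simpa only [Function.comp_def, proj_ofLevelsFun] using hc },
      fun h => by
        ext x
        refine Q.proj_injective _ _ fun i => ?_
        change (Q.proj i).hom (ofLevelsFun P Q f hf (X.ρ (φ h) x)) =
          (Q.proj i).hom (Y.ρ h (ofLevelsFun P Q f hf x))
        rw [proj_ofLevelsFun, TopRep.hom_comm_apply (P.proj i), TopRep.hom_comm_apply (Q.proj i),
          proj_ofLevelsFun]
        exact TopRep.hom_comm_apply (f i) h _⟩

omit [IsTopologicalGroup G] [IsTopologicalGroup H] in
/-- `ofLevelsMap` on elements is `ofLevelsFun`. [cite: NeukirchSchmidtWingberg2008, II §7 (2.7.5)] -/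
@[simp] theorem ofLevelsMap_hom_apply (x : X) :
    (ofLevelsMap P Q f hf).hom x = ofLevelsFun P Q f hf x := rfl

/-- **A morphism of towers over `φ` from levelwise data**: compatible level maps
`f_i : res φ X_i ⟶ Y_i` glue to the limit-level map (`ofLevelsMap`).
[cite: NeukirchSchmidtWingberg2008, II §7 (2.7.5)] -/
def Hom.ofLevels : Hom φ P Q where
  map := ofLevelsMap P Q f hf
  level := f
  proj_map i x := proj_ofLevelsFun P Q f hf x i
  tr_level := hf

omit [IsTopologicalGroup G] [IsTopologicalGroup H] in
/-- The limit-level map of a morphism of towers is determined by its levels (the projections of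
`Q` are jointly injective). [cite: NeukirchSchmidtWingberg2008, II §7 (2.7.5)] -/
theorem Hom.map_hom_apply_eq {F F' : Hom φ P Q} (h : ∀ i, F.level i = F'.level i) (x : X) :
    F.map.hom x = F'.map.hom x :=
  Q.proj_injective _ _ fun i => by rw [F.proj_map, F'.proj_map, h]

end OfLevels

namespace Hom

variable {φ : H →ₜ* G} {X : TopRep.{v} R G} {Y : TopRep.{v} R H}
  {P : DiscreteTowerPresentation X} {Q : DiscreteTowerPresentation Y} (F : Hom φ P Q)

omit [IsTopologicalGroup G] [IsTopologicalGroup H] in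
/-- On cocycles: pulling back along the level maps commutes with pushing along the transitions.
[cite: NeukirchSchmidtWingberg2008, II §7 (2.7.5)] -/
theorem push_tr_pullback_level (i : ℕ) (z : contTwoCocycles (P.obj (i + 1))) :
    contTwoCocycles.push (Q.tr i) (contTwoCocycles.pullback φ (F.level (i + 1)) z) =
      contTwoCocycles.pullback φ (F.level i) (contTwoCocycles.push (P.tr i) z) :=
  Subtype.ext (ContinuousMap.ext fun p => by
    obtain ⟨σ, τ⟩ := p
    change (Q.tr i).hom ((F.level (i + 1)).hom (z.1 (φ σ, φ τ))) =
      (F.level i).hom ((P.tr i).hom (z.1 (φ σ, φ τ)))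
    exact F.tr_level i _)

omit [IsTopologicalGroup G] [IsTopologicalGroup H] in
/-- On cocycles: pulling back along the limit-level map then projecting is pulling back the
projection along the level map. [cite: NeukirchSchmidtWingberg2008, II §7 (2.7.5)] -/
theorem push_proj_pullback_map (i : ℕ) (z : contTwoCocycles X) :
    contTwoCocycles.push (Q.proj i) (contTwoCocycles.pullback φ F.map z) =
      contTwoCocycles.pullback φ (F.level i) (contTwoCocycles.push (P.proj i) z) :=
  Subtype.ext (ContinuousMap.ext fun p => by
    obtain ⟨σ, τ⟩ := p
    change (Q.proj i).hom (F.map.hom (z.1 (φ σ, φ τ))) =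
      (F.level i).hom ((P.proj i).hom (z.1 (φ σ, φ τ)))
    exact F.proj_map i _)

variable [LocallyCompactSpace G] [LocallyCompactSpace H]

/-- The levelwise maps `H²(φ, f_i)` commute with the maps induced by the transitions:
`H²(tr_i) ∘ H²(φ, f_{i+1}) = H²(φ, f_i) ∘ H²(tr_i)`.
[cite: NeukirchSchmidtWingberg2008, II §7 (2.7.5)] -/
theorem cohomologyMap_tr_map_level (i : ℕ) (c : continuousCohomology 2 (P.obj (i + 1))) :
    (cohomologyMap (Q.tr i) 2).hom ((ContinuousCohomology.map φ (F.level (i + 1)) 2).hom c) =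
      (ContinuousCohomology.map φ (F.level i) 2).hom ((cohomologyMap (P.tr i) 2).hom c) := by
  obtain ⟨z, rfl⟩ := twoCocycleClass_surjective _ c
  rw [map_hom_twoCocycleClass, cohomologyMap_hom_twoCocycleClass, cohomologyMap_hom_twoCocycleClass,
    map_hom_twoCocycleClass, push_tr_pullback_level]

/-- **`lim_i H²(φ, f_i) : lim_i H²(G, X_i) → lim_i H²(H, Y_i)`**, the map induced on compatible
families of classes by a morphism of towers over `φ`.
[cite: NeukirchSchmidtWingberg2008, II §7 (2.7.5)] -/
def limitClassesMap : P.limitClasses →+ Q.limitClasses where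
  toFun c := ⟨fun i => (ContinuousCohomology.map φ (F.level i) 2).hom
      ((c : ∀ i, continuousCohomology 2 (P.obj i)) i), fun i => by
    change (cohomologyMap (Q.tr i) 2).hom ((ContinuousCohomology.map φ (F.level (i + 1)) 2).hom
      ((c : ∀ i, continuousCohomology 2 (P.obj i)) (i + 1))) =
      (ContinuousCohomology.map φ (F.level i) 2).hom ((c : ∀ i, continuousCohomology 2 (P.obj i)) i)
    rw [cohomologyMap_tr_map_level, c.2 i]⟩
  map_zero' := Subtype.ext (funext fun i => map_zero _)
  map_add' c c' := Subtype.ext (funext fun i => map_add _ _ _)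

/-- Components of `limitClassesMap`. [cite: NeukirchSchmidtWingberg2008, II §7 (2.7.5)] -/
@[simp] theorem limitClassesMap_apply_coe (c : P.limitClasses) (i : ℕ) :
    (F.limitClassesMap c : ∀ i, continuousCohomology 2 (Q.obj i)) i =
      (ContinuousCohomology.map φ (F.level i) 2).hom ((c : ∀ i, continuousCohomology 2 (P.obj i)) i) :=
  rfl

/-- **Naturality of the comparison map, componentwise**: `H²(proj_i) ∘ H²(φ, f) = H²(φ, f_i) ∘ H²(proj_i)`
on `H²_cts(G, X)`. [cite: NeukirchSchmidtWingberg2008, II §7 (2.7.5)] -/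
theorem cohomologyMap_proj_map (c : continuousCohomology 2 X) (i : ℕ) :
    (cohomologyMap (Q.proj i) 2).hom ((ContinuousCohomology.map φ F.map 2).hom c) =
      (ContinuousCohomology.map φ (F.level i) 2).hom ((cohomologyMap (P.proj i) 2).hom c) := by
  obtain ⟨z, rfl⟩ := twoCocycleClass_surjective X c
  rw [map_hom_twoCocycleClass, cohomologyMap_hom_twoCocycleClass, cohomologyMap_hom_twoCocycleClass,
    map_hom_twoCocycleClass, push_proj_pullback_map]

/-- **Naturality of `toLimitClasses`**: the square
`toLimitClasses_Q ∘ H²(φ, f) = (lim_i H²(φ, f_i)) ∘ toLimitClasses_P` commutes.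
[cite: NeukirchSchmidtWingberg2008, II §7 (2.7.5)] -/
theorem toLimitClasses_map (c : continuousCohomology 2 X) :
    Q.toLimitClasses ((ContinuousCohomology.map φ F.map 2).hom c) =
      F.limitClassesMap (P.toLimitClasses c) :=
  Subtype.ext (funext fun i => F.cohomologyMap_proj_map c i)

/-- **Naturality of `limitClassesEquiv`** (`H²(G, lim X_i) ≅ lim H²(G, X_i)`, finite `H¹` levels):
`limitClassesEquiv_Q (H²(φ, f) c) = (lim_i H²(φ, f_i)) (limitClassesEquiv_P c)`.
[cite: NeukirchSchmidtWingberg2008, II §7 (2.7.6)] -/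
theorem limitClassesEquiv_map (hP : ∀ i, Finite (continuousCohomology 1 (P.obj i)))
    (hQ : ∀ i, Finite (continuousCohomology 1 (Q.obj i))) (c : continuousCohomology 2 X) :
    Q.limitClassesEquiv hQ ((ContinuousCohomology.map φ F.map 2).hom c) =
      F.limitClassesMap (P.limitClassesEquiv hP c) :=
  F.toLimitClasses_map c

/-- The same square through the inverse comparison isomorphisms: `H²(φ, f)` of the class with
levels `d` is the class with levels `(H²(φ, f_i) d_i)_i`.
[cite: NeukirchSchmidtWingberg2008, II §7 (2.7.6)] -/
theorem map_limitClassesEquiv_symm (hP : ∀ i, Finite (continuousCohomology 1 (P.obj i)))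
    (hQ : ∀ i, Finite (continuousCohomology 1 (Q.obj i))) (d : P.limitClasses) :
    (ContinuousCohomology.map φ F.map 2).hom ((P.limitClassesEquiv hP).symm d) =
      (Q.limitClassesEquiv hQ).symm (F.limitClassesMap d) := by
  apply (Q.limitClassesEquiv hQ).injective
  rw [F.limitClassesEquiv_map hP hQ, AddEquiv.apply_symm_apply, AddEquiv.apply_symm_apply]

/-- **A map on `H²` of a limit is determined levelwise** (finite `H¹` levels of `Q`): any additive
map `g : H²(G, X) → H²(H, Y)` whose composites with the `H²(proj_i)` are the `H²(φ, f_i) ∘ H²(proj_i)`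
IS `H²(φ, f)`. [cite: NeukirchSchmidtWingberg2008, II §7 (2.7.6)] -/
theorem map_eq_of_levels (hQ : ∀ i, Finite (continuousCohomology 1 (Q.obj i)))
    (g : continuousCohomology 2 X →+ continuousCohomology 2 Y)
    (hg : ∀ (i : ℕ) (c : continuousCohomology 2 X), (cohomologyMap (Q.proj i) 2).hom (g c) =
      (ContinuousCohomology.map φ (F.level i) 2).hom ((cohomologyMap (P.proj i) 2).hom c))
    (c : continuousCohomology 2 X) : g c = (ContinuousCohomology.map φ F.map 2).hom c :=
  Q.toLimitClasses_injective hQ (Subtype.ext (funext fun i => by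
    rw [toLimitClasses_apply_coe, toLimitClasses_apply_coe, hg, F.cohomologyMap_proj_map]))

end Hom

/-! ### The restriction instance -/

section ResSquare

variable [LocallyCompactSpace G] [LocallyCompactSpace H] {X : TopRep.{v} R G}
  (P : DiscreteTowerPresentation X) (φ : H →ₜ* G)

/-- **Restriction / pull-back along `φ` commutes with the tower projections**:
`H²(proj_i) (φ^* c) = φ^* (H²(proj_i) c)` — for `φ` the inclusion of an open subgroup this is the
compatibility of `Res : H²(G, lim X_i) → H²(H, lim X_i)` with the levelwise restrictions
`H²(G, X_i) → H²(H, X_i)`. [cite: NeukirchSchmidtWingberg2008, II §7 (2.7.5)] -/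
theorem cohomologyMap_proj_res (c : continuousCohomology 2 X) (i : ℕ) :
    (cohomologyMap ((P.restrict φ).proj i) 2).hom
        ((ContinuousCohomology.map φ (𝟙 (res (φ : H →* G) X)) 2).hom c) =
      (ContinuousCohomology.map φ (𝟙 (res (φ : H →* G) (P.obj i))) 2).hom
        ((cohomologyMap (P.proj i) 2).hom c) :=
  (P.restrictHom φ).cohomologyMap_proj_map c i

/-- The restriction square through the comparison isomorphisms: with finite `H¹` levels on both
sides, `limitClassesEquiv (φ^* c)` has components `φ^* (H²(proj_i) c)`.
[cite: NeukirchSchmidtWingberg2008, II §7 (2.7.6)] -/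
theorem limitClassesEquiv_res_apply_coe (hP : ∀ i, Finite (continuousCohomology 1 (P.obj i)))
    (hPφ : ∀ i, Finite (continuousCohomology 1 ((P.restrict φ).obj i)))
    (c : continuousCohomology 2 X) (i : ℕ) :
    ((P.restrict φ).limitClassesEquiv hPφ
        ((ContinuousCohomology.map φ (𝟙 (res (φ : H →* G) X)) 2).hom c) :
          ∀ i, continuousCohomology 2 ((P.restrict φ).obj i)) i =
      (ContinuousCohomology.map φ (𝟙 (res (φ : H →* G) (P.obj i))) 2).hom
        ((P.limitClassesEquiv hP c : ∀ i, continuousCohomology 2 (P.obj i)) i) :=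
  (P.restrictHom φ).cohomologyMap_proj_map c i

end ResSquare

end DiscreteTowerPresentation

end Literature.NumberTheory.GaloisRepresentations

end
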